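import Mathlib
import Literature.NumberTheory.EllipticCurves.PAdicBSD
import HarnessLib

/-!
# CyclotomicIwasawaMainTheoremIrreducible

Topic `Literature/NumberTheory/EllipticCurves`. Named literature fact(s) relocated by the gate from `Summits/BirchSwinnertonDyer/BirchSwinnertonDyer/Theorems/PAdicOrderV2PAdicOrderComparisonR2StubMainConjectureInPrint.lean`
(accept-time relocation of `[cite]`d propositions written inline in a Summits proposal; human ruling 2026-08-15).
Sources: BurungaleCastellaSkinner2025.

* `Literature.NumberTheory.EllipticCurves.burungale_castella_skinner_charIdeal_eq_padicLFunction`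
-/

namespace Literature.NumberTheory.EllipticCurves

open Literature.NumberTheory.EllipticCurves

/-- **bsd.S21′ — Mazur's characteristic-ideal identity `char_Λ X(E/ℚ_∞) = (L_p(E, T))` in
`Λ ⊗ ℚ_p` for irreducible `E[p]`, WITHOUT the auxiliary prime** (A. Burungale, F. Castella,
C. Skinner, Int. Math. Res. Not. IMRN 2025, no. 8, rnaf082 (doi 10.1093/imrn/rnaf082) =
arXiv:2405.00270 (v2, 18 Mar 2025), Thm. 1.1.2 (a), p. 2 — a THEOREM of the source; the
inclusion `(L_p) ⊆ char_Λ X` in `Λ ⊗ ℚ_p` is Kato's, Astérisque 295 (2004), Thm. 17.4, and the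
converse divisibility is proved in §5 (Prop. 5.2.1, Lemma 5.2.3 and "Proof of Theorem 1.1.2",
p. 10) by base change from Wan's divisibility over a quartic CM field — whence `p ≥ 5`). Let
`E/ℚ` be an elliptic curve with globally minimal model `W` and `p ≥ 5` a prime (`hp`) of good
ordinary reduction (`hgood`, `hord : p ∤ a_p`) such that `E[p]` is an irreducible `G_ℚ`-module
(`hirr`, B–C–S's condition (irr_ℚ)). Let `ℚ_∞/ℚ` be the cyclotomic `ℤ_p`-extension (`hκ`) with
topological generator `γ` (`hγ`) matching the cyclotomic variable (`hγ'`, `IsCyclotomicVariable`),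
`f` the newform of `E` (`hf`), `L_p(E, T) = padicLFunction f α` (`α = unitRoot W p`) and
`X = X(E/ℚ_∞) = D.X` the Iwasawa module of the dual datum `D` (`Λ = ℤ_p⟦T⟧`, `T = γ - 1`).
These are, binder for binder, the hypotheses of the Skinner–Urban named fact bsd.S21 of
`Literature/NumberTheory/EllipticCurves/PAdicBSD.lean` with its auxiliary-prime hypothesis `haux`
(S–U's (mult): a prime `ℓ ‖ N`, `ℓ ≠ p`, at which `ρ̄_{E,p}` is ramified) DROPPED and `3 ≤ p`
sharpened to `5 ≤ p`, and the conclusion is clauses (1)–(2) of bsd.S21 verbatim. Then: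
1. `X` is a torsion `Λ`-module;
2. `char_Λ X = (L_p(E, T))` in `Λ ⊗_{ℤ_p} ℚ_p = Λ[1/p]`: there are `g ∈ Λ` and `k ∈ ℤ` with
   `char_Λ X = Λ g` and `ι g = p^k · L_p(E, T)` (`ι = iwasawaToPowerSeries p : Λ ↪ ℚ_p⟦T⟧`; the
   units of `Λ[1/p]` are `p^ℤ · Λˣ`, `p` being a prime element of the UFD `Λ`, so two principal
   ideals of `Λ[1/p]` agree iff their generators differ by `p^k` times a unit of `Λ`; see the
   module docstring of `PAdicBSD`, "`Λ ⊗ ℚ_p` versus `ℚ_p⟦T⟧`").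
As printed (Thm. 1.1.2 (a), p. 2): "Let `E` be an elliptic curve defined over `ℚ` and `p` a prime
of good ordinary reduction for `E`. (a) If `p > 3` satisfies (irr_ℚ), then `X^ord(E/ℚ_∞)` is
`Λ`-torsion, with `ch_Λ(X^ord(E/ℚ_∞)) = (L_p(E/ℚ))` in `Λ ⊗ ℚ_p`." Here (p. 1) `Λ = ℤ_p⟦Γ⟧`,
`Γ = Gal(ℚ_∞/ℚ)`; `X^ord(E/ℚ_∞) := Hom_{ℤ_p}(Sel_{p^∞}(E/ℚ_∞), ℚ_p/ℤ_p)` is the Pontryagin dual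
of the `p^∞`-Selmer group over `ℚ_∞`, i.e. `D.X` (`IwasawaSelmer`: `D.toDual` identifies `D.X`
with `Hom(Sel_{p^∞}(E/ℚ_∞), ℚ/ℤ)`; `ch_Λ` of the torsion module `X` is `D.charIdeal`); (irr_ℚ)
(p. 2) is "`E[p]` is an irreducible `G_ℚ`-module" (`WeierstrassCurve.HasIrreducibleModPGaloisRep`);
and (p. 1) "`L_p(E/ℚ) ∈ Λ ⊗ ℚ_p`" is "the `p`-adic `L`-function attached to `E` by
Mazur–Swinnerton-Dyer", normalised by a real period of `E` (the Néron period `Ω_E` in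
Mazur–Tate–Teitelbaum's convention), hence equal to `ϖ · padicLFunction f α` for a rational
`ϖ ≠ 0` (for `Ω_E`: the `ϖ > 0` with `ϖ · Ω_E = Ω⁺_f`, module docstring of `PAdicBSD`,
Normalisations). Since `ϖ ∈ ℚˣ` is `p^m · u` with `m ∈ ℤ` and `u` a `p`-adic unit, the
principal ideals of `Λ[1/p]` generated by `L_p(E/ℚ)` and by `padicLFunction f α` coincide, the
exponent `k ∈ ℤ` of clause 2 absorbing `p^m`: clause 2 is insensitive to `ϖ`, exactly as
clause 2 of bsd.S21. The identification of `ℤ_p⟦Γ⟧` with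
`ℤ_p⟦T⟧`, `T = γ - 1`, compatibly with the variable `T = γ_cyc - 1` of `padicLFunction`, is the
hypothesis `IsCyclotomicVariable p γ` (`hγ'`), as in bsd.S20/S21 (design note "The variable `T`
on both sides" of `PAdicBSD`); `hκ`/`hγ` fix `κ` among its unit twists as there. No `_holds`
(Kato's Euler system, the Skinner–Urban / Wan Eisenstein-congruence divisibilities on unitary
groups and Hida theory over CM fields are not in Mathlib or the tree); consumers take
`(hBCS : burungale_castella_skinner_charIdeal_eq_padicLFunction)`.
-- TODO(general form): part (b) of Thm. 1.1.2 — the same equality in `Λ` itself under (im)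
-- `∃ σ ∈ G_{ℚ(μ_{p^∞})}, T_pE/(σ - 1)T_pE ≃ ℤ_p` (no tree vocabulary for (im); the stronger
-- "`ρ_{E,p}` surjective" integral clause is clause 3 of bsd.S20/S21); and the main text's
-- version for weight-two newforms `g ∈ S₂(Γ₀(N))` good ordinary at `p ≥ 5` with `ρ̄_g`
-- irreducible (§5), of which the elliptic-curve case is the one stated here.
[cite: BurungaleCastellaSkinner2025, Thm. 1.1.2 (a) (p. 2 of arXiv:2405.00270v2)]
[file NumberTheory/EllipticCurves/CyclotomicIwasawaMainTheoremIrreducible] -/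
def burungale_castella_skinner_charIdeal_eq_padicLFunction : Prop :=
  ∀ (W : WeierstrassCurve ℚ) [W.IsElliptic] [W.IsGloballyMinimal] (p : ℕ) [Fact p.Prime]
    (κ : Literature.NumberTheory.EllipticCurves.ZpExtension ℚ p) (γ : Field.absoluteGaloisGroup ℚ)
    {N : ℕ} [NeZero N] (f : CuspForm (CongruenceSubgroup.Gamma0 N) 2)
    (hp : 5 ≤ p) (hgood : W.HasGoodReductionAtPrime p) (hord : ¬ (p : ℤ) ∣ W.frobeniusTrace p)
    (hirr : W.HasIrreducibleModPGaloisRep p) (hκ : κ.IsCyclotomic) (hγ : κ.IsTopGenerator γ)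
    (hγ' : Literature.NumberTheory.EllipticCurves.IsCyclotomicVariable p γ)
    (hf : Literature.NumberTheory.EllipticCurves.ModularForms.IsNewformOf W f)
    (D : W.SelmerDualData κ γ),
    D.IsTorsion ∧
      ∃ (g : Literature.NumberTheory.EllipticCurves.IwasawaAlgebra p) (k : ℤ),
        D.charIdeal = Ideal.span {g} ∧
          Literature.NumberTheory.EllipticCurves.iwasawaToPowerSeries p g =
            PowerSeries.C ((p : ℚ_[p]) ^ k) *
              Literature.NumberTheory.EllipticCurves.padicLFunction f
                (Literature.NumberTheory.EllipticCurves.unitRoot W p : ℚ_[p])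

end Literature.NumberTheory.EllipticCurves
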